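import Mathlib.Algebra.MvPolynomial.Equiv
import Mathlib.RingTheory.Ideal.Span
import Literature.Computability.AlgebraicComplexity.BurgisserBooleanPartsA3Steps
import HarnessLib

/-!
# The coefficient ideal of the integer skeleton of a circuit against a target polynomial

Setting of `BurgisserBooleanPartsA3Steps.lean` (Bürgisser, *Cook's versus Valiant's hypothesis*,
TCS 235 (2000), §5 (A3), p. 85): a circuit `P` over `k` with `s` gates has the constant-free
**integer skeleton** `skeleton P`, a circuit over `ℤ` in the variables `X_i` of `P` and the slot
indeterminates `Y_0, …, Y_{4s}` ("Replace the `y_j` by indeterminates `Y_j` and let `F(X, Y)`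
denote the integer polynomial computed … from the `X_i` and `Y_j`"), computing
`F = (skeleton P).eval ∈ ℤ[X, Y]`, and substituting the constants `slotConst P` of `P` back for
`Y` gives `F(X, y) = P.eval` (`aeval_slotSubst_skeleton`).

Fix an integer target polynomial `g ∈ ℤ[X]`. Writing `F(X, Y) = ∑_α F_α(Y) X^α`
(`MvPolynomial.sumAlgEquiv`), the **coefficient identities** of the skeleton against `g` are the
integer polynomials `F_α(Y) - g_α ∈ ℤ[Y]` (`circuitCoeffPoly P g α`), and the **circuit
coefficient ideal** `circuitCoeffIdeal P g ⊆ ℚ[Y_0, …, Y_{4s}]` is the ideal they generate over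
`ℚ`. Its zero set in `K^{4s+1}` (`K` any commutative `ℚ`-algebra) is the set of constant vectors
`y` with `F(X, y) = g` as polynomials (`forall_mem_circuitCoeffIdeal_iff`) — the *circuit
(coefficient) variety* of the skeleton of `P` at `g`: the fibre over `g` of the map
`y ↦ F(X, y)` from constants to computed polynomials. This is the polynomial-identity refinement
of Bürgisser's system `(S_n)`: `F_n(x, Y) - f_n(x) = 0` for all `x ∈ {0,1}ⁿ` (p. 85), which only
asks for agreement of values on Boolean inputs; every zero of the coefficient ideal is a solution
of `(S_n)`.

## Main statements

* `circuitCoeffPoly`, `circuitCoeffIdeal` — the definitions.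
* `aeval_circuitCoeffPoly`, `forall_aeval_circuitCoeffPoly_eq_zero_iff` — over any commutative
  ring `A`: `y ∈ A^{4s+1}` kills every `F_α - g_α` iff `F(X, y) = g` in `A[X]` (the form usable
  over finite fields and finite rings).
* `forall_mem_circuitCoeffIdeal_iff` — the zero set of the ideal over a `ℚ`-algebra.
* `aeval_slotConst_eq_zero_of_computes` — if the fan-in-two circuit `P` computes (the image of)
  `g`, its own constants `slotConst P` form a `k`-point of the circuit coefficient ideal.
* `circuitCoeffSupport`, `circuitCoeffIdeal_eq_span_image`, `circuitCoeffIdeal_fg` — only the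
  finitely many exponents `α` in the support of `F` (over `ℤ[Y]`) or of `g` give nonzero
  identities, so the ideal is the span of those finitely many generators.
* `totalDegree_circuitCoeffPoly_le`, `weight_circuitCoeffPoly_le` — the generators have degree
  `≤ 2^{3s}` and weight `≤ 2^{2^{3s}} + |g_α|` (`s` = number of gates of `P`; the size form of
  Bürgisser's Lemma 2.4 applied to the skeleton), through the general two-block lemmas
  `coeff_coeff_sumAlgEquiv`, `totalDegree_coeff_sumAlgEquiv_le`, `weight_coeff_sumAlgEquiv_le`.

## Design notes

The ideal depends on `P` only through the shape of its gates (which operands are constants) and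
its size, not on the values of its constants: all constants are replaced by slot indeterminates.
It is taken over `ℚ` (as requested by the route using it); the integer polynomials
`circuitCoeffPoly` keep the arithmetic information (reduction modulo primes, weights). Not here:
zero sets as schemes or varieties, irreducible components and their fields of definition, and the
depth form of Bürgisser's Lemma 2.4 (degree `2^{depth}`); only the size form of the parent file is
used for the bounds.

## References

* P. Bürgisser, *Cook's versus Valiant's hypothesis*, Theoret. Comput. Sci. 235 (2000) 71–88,
  Lemma 2.4 p. 77 (degree and weight of straight-line programs), §5 (A3) p. 85 (the skeleton
  `F_n(X, Y)` and the system `(S_n)`). [Burgisser2000TCS]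
-/

noncomputable section

open MvPolynomial

namespace Literature.Computability.AlgebraicComplexity

open ArithCircuit

variable {k : Type*} {σ : Type*}

/-! ### Coefficients in two blocks of variables -/

/-- Substituting values `y` for the second block of variables in the `α`-th coefficient (with
respect to the first block) of `F ∈ R[X, Y]` gives the `α`-th coefficient of `F(X, y)`.
[folklore] -/
theorem aeval_coeff_sumAlgEquiv {R : Type*} [CommRing R] {A : Type*} [CommRing A] [Algebra R A]
    {τ π : Type*} (y : π → A) (α : τ →₀ ℕ) (F : MvPolynomial (τ ⊕ π) R) :
    aeval y (coeff α (sumAlgEquiv R τ π F)) =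
      coeff α (aeval (Sum.elim X fun v => C (y v) : τ ⊕ π → MvPolynomial τ A) F) := by
  have key : (MvPolynomial.map (aeval y : MvPolynomial π R →ₐ[R] A).toRingHom).comp
        (sumAlgEquiv R τ π).toAlgHom.toRingHom =
      (aeval (Sum.elim X fun v => C (y v) : τ ⊕ π → MvPolynomial τ A)).toRingHom := by
    apply ringHom_ext
    · intro a
      simp [sumAlgEquiv_C_inl, MvPolynomial.algebraMap_apply]
    · rintro (t | p)
      · simp [sumAlgEquiv_X_inl]
      · simp [sumAlgEquiv_X_inr]
  have := congrArg (fun f : MvPolynomial (τ ⊕ π) R →+* MvPolynomial τ A => coeff α (f F)) key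
  simpa [coeff_map] using this

/-- Over a `ℚ`-algebra, evaluating the rational image of an integer polynomial is evaluating the
integer polynomial. [folklore] -/
theorem aeval_map_intCastRingHom_rat {A : Type*} [CommRing A] [Algebra ℚ A] {τ : Type*}
    (y : τ → A) (q : MvPolynomial τ ℤ) :
    aeval y (map (Int.castRingHom ℚ) q) = aeval y q := by
  rw [aeval_def, eval₂_map, aeval_def]
  congr 1
  exact RingHom.ext_int _ _

/-- The exponent splitting `sumFinsuppAddEquivProdFinsupp` inverts `Finsupp.sumElim`. [folklore] -/
theorem sumFinsuppAddEquivProdFinsupp_symm_eq {τ π : Type*} (α : τ →₀ ℕ) (β : π →₀ ℕ) :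
    Finsupp.sumFinsuppAddEquivProdFinsupp.symm (α, β) = α.sumElim β := by
  ext (i | j)
  · rw [Finsupp.sumFinsuppAddEquivProdFinsupp_symm_inl, Finsupp.sumElim_inl]
  · rw [Finsupp.sumFinsuppAddEquivProdFinsupp_symm_inr, Finsupp.sumElim_inr]

/-- The exponent splitting of `α.sumElim β` is `(α, β)`. [folklore] -/
theorem sumFinsuppAddEquivProdFinsupp_sumElim {τ π : Type*} (α : τ →₀ ℕ) (β : π →₀ ℕ) :
    Finsupp.sumFinsuppAddEquivProdFinsupp (α.sumElim β) = (α, β) := by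
  rw [← sumFinsuppAddEquivProdFinsupp_symm_eq, AddEquiv.apply_symm_apply]

/-- `sumAlgEquiv` on a monomial: split the exponent. [folklore] -/
theorem sumAlgEquiv_monomial {R : Type*} [CommSemiring R] {τ π : Type*} (m : τ ⊕ π →₀ ℕ) (c : R) :
    sumAlgEquiv R τ π (monomial m c) =
      monomial (Finsupp.sumFinsuppAddEquivProdFinsupp m).1
        (monomial (Finsupp.sumFinsuppAddEquivProdFinsupp m).2 c) := by
  simp only [sumAlgEquiv, AlgEquiv.trans_apply, ← single_eq_monomial]
  rw [AddMonoidAlgebra.domCongr_single]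
  exact AddMonoidAlgebra.curryAlgEquiv_single _ _ _

/-- **Coefficients in two blocks**: the `β`-coefficient of the `α`-coefficient of `F` viewed in
`(R[Y])[X]` is the `(α, β)`-coefficient of `F ∈ R[X, Y]`. [folklore] -/
theorem coeff_coeff_sumAlgEquiv {R : Type*} [CommSemiring R] {τ π : Type*}
    (F : MvPolynomial (τ ⊕ π) R) (α : τ →₀ ℕ) (β : π →₀ ℕ) :
    coeff β (coeff α (sumAlgEquiv R τ π F)) = coeff (α.sumElim β) F := by
  classical
  induction F using MvPolynomial.induction_on' with
  | monomial m c =>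
    rw [sumAlgEquiv_monomial, coeff_monomial, coeff_monomial]
    by_cases h : m = α.sumElim β
    · subst h
      rw [sumFinsuppAddEquivProdFinsupp_sumElim, if_pos rfl, coeff_monomial, if_pos rfl, if_pos rfl]
    · rw [if_neg h]
      have hne : ¬ ((Finsupp.sumFinsuppAddEquivProdFinsupp m).1 = α ∧
          (Finsupp.sumFinsuppAddEquivProdFinsupp m).2 = β) := by
        rintro ⟨h1, h2⟩
        apply h
        rw [← sumFinsuppAddEquivProdFinsupp_symm_eq, ← h1, ← h2, Prod.mk.eta,
          AddEquiv.symm_apply_apply]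
      by_cases h1 : (Finsupp.sumFinsuppAddEquivProdFinsupp m).1 = α
      · rw [if_pos h1, coeff_monomial, if_neg (fun h2 => hne ⟨h1, h2⟩)]
      · rw [if_neg h1, coeff_zero]
  | add p q hp hq => simp [coeff_add, hp, hq]

/-- The coefficients of `F` viewed in `(R[Y])[X]` have total degree (in `Y`) at most the total
degree of `F`. [folklore] -/
theorem totalDegree_coeff_sumAlgEquiv_le {R : Type*} [CommSemiring R] {τ π : Type*}
    (F : MvPolynomial (τ ⊕ π) R) (α : τ →₀ ℕ) :
    (coeff α (sumAlgEquiv R τ π F)).totalDegree ≤ F.totalDegree := by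
  refine Finset.sup_le fun β hβ => ?_
  rw [mem_support_iff, coeff_coeff_sumAlgEquiv] at hβ
  refine le_trans ?_ (le_totalDegree (mem_support_iff.2 hβ))
  rw [Finsupp.sum_sumElim]
  exact le_add_self

/-- The coefficients of an integer polynomial `F` viewed in `(ℤ[Y])[X]` have weight at most the
weight of `F` (their coefficients are some of the coefficients of `F`). [folklore] -/
theorem weight_coeff_sumAlgEquiv_le {τ π : Type*} (F : MvPolynomial (τ ⊕ π) ℤ) (α : τ →₀ ℕ) :
    weight (coeff α (sumAlgEquiv ℤ τ π F)) ≤ weight F := by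
  classical
  have hinj : Function.Injective (α.sumElim : (π →₀ ℕ) → (τ ⊕ π →₀ ℕ)) := fun β β' h => by
    simpa [Finsupp.comapDomain_inr_sumElim] using
      congrArg (fun m => Finsupp.comapDomain Sum.inr m Sum.inr_injective.injOn) h
  calc weight (coeff α (sumAlgEquiv ℤ τ π F))
      = ∑ β ∈ (coeff α (sumAlgEquiv ℤ τ π F)).support, (F.coeff (α.sumElim β)).natAbs := by
        unfold weight
        exact Finset.sum_congr rfl fun β _ => by rw [coeff_coeff_sumAlgEquiv]
    _ = ∑ m ∈ (coeff α (sumAlgEquiv ℤ τ π F)).support.image α.sumElim, (F.coeff m).natAbs := by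
        rw [Finset.sum_image fun β _ β' _ h => hinj h]
    _ ≤ weight F := by
        unfold weight
        refine Finset.sum_le_sum_of_subset_of_nonneg ?_ fun _ _ _ => Nat.zero_le _
        intro m hm
        obtain ⟨β, hβ, rfl⟩ := Finset.mem_image.1 hm
        rw [mem_support_iff, coeff_coeff_sumAlgEquiv] at hβ
        exact mem_support_iff.2 hβ

/-! ### The coefficient identities and the coefficient ideal -/

/-- The `α`-th **coefficient identity** of the integer skeleton of `P` against the target `g`:
the integer polynomial `F_α(Y) - g_α` in the slot indeterminates `Y_0, …, Y_{4s}`, where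
`F(X, Y) = ∑_α F_α(Y) X^α` is the polynomial computed by `skeleton P` and `g = ∑_α g_α X^α`
(the polynomial-identity form of Bürgisser's system `(S_n)`, TCS 2000 §5 (A3) p. 85). [cite: Burgisser2000TCS, §5 (A3) p. 85] -/
def circuitCoeffPoly (P : ArithCircuit k σ) (g : MvPolynomial σ ℤ) (α : σ →₀ ℕ) :
    MvPolynomial (Fin (4 * P.size + 1)) ℤ :=
  coeff α (sumAlgEquiv ℤ σ (Fin (4 * P.size + 1)) (skeleton P).eval) - C (coeff α g)

/-- The **circuit coefficient ideal** of the integer skeleton of `P` against the target `g`: the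
ideal of `ℚ[Y_0, …, Y_{4s}]` generated by the rational images of all coefficient identities
`F_α(Y) - g_α`, `α : σ →₀ ℕ`. Its zero set (in any commutative `ℚ`-algebra) is the set of constant
vectors `y` with `F(X, y) = g` — the circuit (coefficient) variety of the skeleton of `P` at `g`
(`forall_mem_circuitCoeffIdeal_iff`); cf. Bürgisser's system `(S_n)`, TCS 2000 §5 (A3) p. 85,
which imposes `F(x, Y) = g(x)` only at Boolean points `x`. [cite: Burgisser2000TCS, §5 (A3) p. 85] -/
def circuitCoeffIdeal (P : ArithCircuit k σ) (g : MvPolynomial σ ℤ) :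
    Ideal (MvPolynomial (Fin (4 * P.size + 1)) ℚ) :=
  Ideal.span (Set.range fun α : σ →₀ ℕ => map (Int.castRingHom ℚ) (circuitCoeffPoly P g α))

/-- Unfolding lemma for `circuitCoeffPoly`. [folklore] -/
theorem circuitCoeffPoly_def (P : ArithCircuit k σ) (g : MvPolynomial σ ℤ) (α : σ →₀ ℕ) :
    circuitCoeffPoly P g α =
      coeff α (sumAlgEquiv ℤ σ (Fin (4 * P.size + 1)) (skeleton P).eval) - C (coeff α g) :=
  rfl

/-- Unfolding lemma for `circuitCoeffIdeal`. [folklore] -/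
theorem circuitCoeffIdeal_def (P : ArithCircuit k σ) (g : MvPolynomial σ ℤ) :
    circuitCoeffIdeal P g =
      Ideal.span (Set.range fun α : σ →₀ ℕ =>
        map (Int.castRingHom ℚ) (circuitCoeffPoly P g α)) :=
  rfl

/-- The generators belong to the ideal. [folklore] -/
theorem map_circuitCoeffPoly_mem (P : ArithCircuit k σ) (g : MvPolynomial σ ℤ) (α : σ →₀ ℕ) :
    map (Int.castRingHom ℚ) (circuitCoeffPoly P g α) ∈ circuitCoeffIdeal P g :=
  Ideal.subset_span ⟨α, rfl⟩

/-! ### Degree and weight of the coefficient identities -/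

/-- **Degree bound**: every coefficient identity of a circuit with `s` gates has total degree
`≤ 2^{3s}` in the slot indeterminates (size form of Bürgisser's Lemma 2.4 for the skeleton,
`totalDegree_eval_le_two_pow_size`, `size_skeleton`). [cite: Burgisser2000TCS, Lemma 2.4 p. 77 and §5 (A3) p. 85] -/
theorem totalDegree_circuitCoeffPoly_le (P : ArithCircuit k σ) (g : MvPolynomial σ ℤ)
    (α : σ →₀ ℕ) : (circuitCoeffPoly P g α).totalDegree ≤ 2 ^ (3 * P.size) := by
  rw [circuitCoeffPoly]
  refine (totalDegree_sub _ _).trans (max_le ?_ (by rw [totalDegree_C]; exact Nat.zero_le _))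
  refine (totalDegree_coeff_sumAlgEquiv_le _ _).trans ?_
  rw [← size_skeleton P]
  exact totalDegree_eval_le_two_pow_size (isFanInTwo_skeleton P)

/-- **Weight bound**: every coefficient identity of a circuit with `s` gates against `g` has
weight `≤ 2^{2^{3s}} + |g_α|` (size form of Bürgisser's Lemma 2.4 for the skeleton,
`weight_eval_le_two_pow_two_pow_size`, `size_skeleton`). [cite: Burgisser2000TCS, Lemma 2.4 p. 77 and §5 (A3) p. 85] -/
theorem weight_circuitCoeffPoly_le (P : ArithCircuit k σ) (g : MvPolynomial σ ℤ) (α : σ →₀ ℕ) :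
    weight (circuitCoeffPoly P g α) ≤ 2 ^ 2 ^ (3 * P.size) + (coeff α g).natAbs := by
  rw [circuitCoeffPoly, sub_eq_add_neg, ← C_neg]
  refine (weight_add_le _ _).trans (add_le_add ?_ (by rw [weight_C, Int.natAbs_neg]))
  refine (weight_coeff_sumAlgEquiv_le _ _).trans ?_
  rw [← size_skeleton P]
  exact weight_eval_le_two_pow_two_pow_size (isFanInTwo_skeleton P) (hasSignConstants_skeleton P)

/-! ### Zeros: points of the circuit coefficient variety -/

/-- The value of the `α`-th coefficient identity at `y ∈ A^{4s+1}` (any commutative ring `A`) is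
`coeff_α F(X, y) - g_α`. [folklore] -/
theorem aeval_circuitCoeffPoly {A : Type*} [CommRing A] (P : ArithCircuit k σ)
    (g : MvPolynomial σ ℤ) (α : σ →₀ ℕ) (y : Fin (4 * P.size + 1) → A) :
    aeval y (circuitCoeffPoly P g α) =
      coeff α (aeval (Sum.elim X fun v => C (y v) : _ → MvPolynomial σ A) (skeleton P).eval) -
        coeff α (map (Int.castRingHom A) g) := by
  rw [circuitCoeffPoly, map_sub, aeval_coeff_sumAlgEquiv, aeval_C, coeff_map, algebraMap_int_eq]

/-- **Points over any commutative ring.** `y ∈ A^{4s+1}` is a common zero of all coefficient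
identities iff substituting `y` for the slot indeterminates in the skeleton polynomial gives the
image of `g` in `A[X]`. [folklore] -/
theorem forall_aeval_circuitCoeffPoly_eq_zero_iff {A : Type*} [CommRing A] (P : ArithCircuit k σ)
    (g : MvPolynomial σ ℤ) (y : Fin (4 * P.size + 1) → A) :
    (∀ α, aeval y (circuitCoeffPoly P g α) = 0) ↔
      aeval (Sum.elim X fun v => C (y v) : _ → MvPolynomial σ A) (skeleton P).eval =
        map (Int.castRingHom A) g := by
  simp only [aeval_circuitCoeffPoly, sub_eq_zero, MvPolynomial.ext_iff]

/-- **The zero set of the circuit coefficient ideal.** For a commutative `ℚ`-algebra `A`, a point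
`y ∈ A^{4s+1}` kills the whole ideal iff substituting `y` for the slot indeterminates in the
skeleton polynomial gives the image of `g` in `A[X]`. [folklore] -/
theorem forall_mem_circuitCoeffIdeal_iff {A : Type*} [CommRing A] [Algebra ℚ A]
    (P : ArithCircuit k σ) (g : MvPolynomial σ ℤ) (y : Fin (4 * P.size + 1) → A) :
    (∀ f ∈ circuitCoeffIdeal P g, aeval y f = 0) ↔
      aeval (Sum.elim X fun v => C (y v) : _ → MvPolynomial σ A) (skeleton P).eval =
        map (Int.castRingHom A) g := by
  rw [← forall_aeval_circuitCoeffPoly_eq_zero_iff]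
  constructor
  · intro h α
    rw [← aeval_map_intCastRingHom_rat]
    exact h _ (map_circuitCoeffPoly_mem P g α)
  · intro h f hf
    have hle : circuitCoeffIdeal P g ≤
        RingHom.ker (aeval y : MvPolynomial (Fin (4 * P.size + 1)) ℚ →ₐ[ℚ] A) := by
      refine Ideal.span_le.2 ?_
      rintro _ ⟨α, rfl⟩
      rw [SetLike.mem_coe, RingHom.mem_ker, aeval_map_intCastRingHom_rat]
      exact h α
    exact (RingHom.mem_ker).1 (hle hf)

/-- **The constants of `P` are a point.** If the fan-in-two circuit `P` over a commutative
`ℚ`-algebra `k` computes the image of the integer polynomial `g`, then its constant vector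
`slotConst P` is a `k`-point of the circuit coefficient ideal of its skeleton against `g`
(Bürgisser 2000 TCS, §5 (A3) p. 85: "Obviously, `F_n(X, y) = f_n`, hence the system … has a
solution `y ∈ k^{m(n)}`"). [cite: Burgisser2000TCS, §5 (A3) p. 85] -/
theorem aeval_slotConst_eq_zero_of_computes [CommRing k] [Algebra ℚ k] (P : ArithCircuit k σ)
    (h2 : P.IsFanInTwo) {g : MvPolynomial σ ℤ} (hg : P.Computes (map (Int.castRingHom k) g))
    {f : MvPolynomial (Fin (4 * P.size + 1)) ℚ} (hf : f ∈ circuitCoeffIdeal P g) :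
    aeval (fun v : Fin (4 * P.size + 1) => slotConst P v) f = 0 :=
  (forall_mem_circuitCoeffIdeal_iff P g _).2 ((aeval_slotSubst_skeleton P h2).trans hg) f hf

/-- Integer form of the previous statement, over any commutative ring `k`: the constants of a
fan-in-two circuit computing the image of `g` kill every coefficient identity. [cite: Burgisser2000TCS, §5 (A3) p. 85] -/
theorem aeval_slotConst_circuitCoeffPoly_of_computes [CommRing k] (P : ArithCircuit k σ)
    (h2 : P.IsFanInTwo) {g : MvPolynomial σ ℤ} (hg : P.Computes (map (Int.castRingHom k) g))
    (α : σ →₀ ℕ) :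
    aeval (fun v : Fin (4 * P.size + 1) => slotConst P v) (circuitCoeffPoly P g α) = 0 :=
  (forall_aeval_circuitCoeffPoly_eq_zero_iff P g _).2 ((aeval_slotSubst_skeleton P h2).trans hg) α

/-! ### Finitely many generators -/

/-- The finitely many exponents `α` that can carry a nonzero coefficient identity: the support
of `F` as a polynomial in `X` over `ℤ[Y]` together with the support of `g`. [folklore] -/
def circuitCoeffSupport [DecidableEq σ] (P : ArithCircuit k σ) (g : MvPolynomial σ ℤ) :
    Finset (σ →₀ ℕ) :=
  (sumAlgEquiv ℤ σ (Fin (4 * P.size + 1)) (skeleton P).eval).support ∪ g.support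

/-- Outside `circuitCoeffSupport` the coefficient identity is `0 - 0`. [folklore] -/
theorem circuitCoeffPoly_eq_zero_of_not_mem [DecidableEq σ] {P : ArithCircuit k σ}
    {g : MvPolynomial σ ℤ} {α : σ →₀ ℕ} (hα : α ∉ circuitCoeffSupport P g) :
    circuitCoeffPoly P g α = 0 := by
  simp only [circuitCoeffSupport, Finset.mem_union, not_or, notMem_support_iff] at hα
  rw [circuitCoeffPoly, hα.1, hα.2, C_0, sub_zero]

/-- **Span over all exponents = span over the finite support**: the circuit coefficient ideal is
generated by the finitely many identities indexed by `circuitCoeffSupport P g`. [folklore] -/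
theorem circuitCoeffIdeal_eq_span_image [DecidableEq σ] (P : ArithCircuit k σ)
    (g : MvPolynomial σ ℤ) :
    circuitCoeffIdeal P g =
      Ideal.span ((fun α => map (Int.castRingHom ℚ) (circuitCoeffPoly P g α)) ''
        (circuitCoeffSupport P g : Set (σ →₀ ℕ))) := by
  refine le_antisymm (Ideal.span_le.2 ?_) (Ideal.span_mono (Set.image_subset_range _ _))
  rintro _ ⟨α, rfl⟩
  by_cases hα : α ∈ circuitCoeffSupport P g
  · exact Ideal.subset_span ⟨α, hα, rfl⟩
  · dsimp only
    rw [circuitCoeffPoly_eq_zero_of_not_mem hα, map_zero]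
    exact Ideal.zero_mem _

/-- The circuit coefficient ideal is finitely generated (by the identities indexed by
`circuitCoeffSupport P g`). [folklore] -/
theorem circuitCoeffIdeal_fg [DecidableEq σ] (P : ArithCircuit k σ) (g : MvPolynomial σ ℤ) :
    (circuitCoeffIdeal P g).FG :=
  ⟨(circuitCoeffSupport P g).image fun α => map (Int.castRingHom ℚ) (circuitCoeffPoly P g α),
    by rw [Finset.coe_image, circuitCoeffIdeal_eq_span_image]⟩

end Literature.Computability.AlgebraicComplexity
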